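import Mathlib
import HarnessLib
import HarnessLib.Audit
import Summits.QuantumFields.Statement
import Summits.QuantumFields.YangMills.Theses.ToronSmallBall
import Summits.QuantumFields.YangMills.Theorems.QuantileBitPuritySectorDefs
import Summits.QuantumFields.YangMills.Theorems.QuantileBitPurityQuantileBit
import Summits.QuantumFields.YangMills.Theorems.SwapTwistDeficitSmallBallFloors
import HarnessLib.Audit.Status.Attr

/-!
Route: FluxSectorLaplace

# Route FluxSectorLaplace — Electric-flux sector suppression on the Laplace window — rigid twisted
flat connections versus the toron core

D-0145 LINE g13-B of ideator seat ym-idea-4 (technique card «spectral / trace methods»). TARGET LEAF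
BY NAME: `ToronSmallBall.ToronCoreRaritySubQuartic` (item stmt-QuantumFields-23956, crux rank 2 of
route-QuantumFields-ToronSmallBall = LINE g12-A; bears_on R2ξ″ via 23956 → Assembly2 23958 (proved,
p687145) → `SwapTwistDeficit.TwistDeficitLaplaceWindow` 23776 → 23317 → K2a 28291 →
`AllWindowsColdBox.XiSuperPolySU2` 22804; RECORD label — no summit is proved by this line). The leaf
says: on the Laplace window L ≤ β^a the slice-0 thermal weight of the collapsed toron CORE {polDist
≤ β^(−γc)}, γc ≤ 2/5, in the 2L-slice zero-flux ring is ≤ β^(−a)·Z_phys(2L). Prover ym-dw-p1 g14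
found (memo HOME bc/g14-dw/SECTORS-translates.md, 2026-08-29) that the zero-flux seam `physAvg` =
(1/8)Σ over the eight centre-twist SECTORS z ∈ (ℤ/2)³ ('t Hooft temporal twists = electric-flux
characters), that on the GOOD event the three sectors twisted only in y and/or z lie INSIDE the core
(untwisted holonomies are pinned to the centre), and that the sheet-translate machinery of PLAN-X1
compares events only INSIDE one sector — so 23956 secretly contains an ELECTRIC-FLUX FREE-ENERGY
input. It suffices to show X = FluxSectorSuppression ∧ PeriodicCoreRaritySubQuartic: (K1) every
twisted sector z ≠ 0 has total weight ≤ β^(−a)·Z_phys(2L) on the window, and (K2) inside the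
periodic sector z = 0 the core carries weight ≤ β^(−a)·Z_phys(2L); with the exact sector
decomposition and monotonicity of sector weights (supports S1, S2) the eight-term sum gives the
leaf.
Lean: `FluxSectorSuppression → PeriodicCoreRaritySubQuartic → SectorDecomposition →
SectorWeightMonotone →
Summit.QuantumFields.YangMills.Theses.ToronSmallBall.ToronCoreRaritySubQuartic`

## Assembly
insTrace(CORE) = ringInsTrace at n = 2L−1 (rfl, `TT.ringInsTrace_two_mul_sub_one`) = (1/8)Σ_z
W_z(CORE) by S1; for z = 0 use K2, for z ≠ 0 use S2 then K1; with a = min(a₁,a₂), β ≥ max(β₁,β₂,1),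
L ≥ max(L₁,L₂,1) every one of the eight terms is ≤ β^(−a)·Z_phys(2L) (Z_phys > 0 by
`TT.physTrace_two_mul_pos`, exponent monotonicity `Real.rpow_le_rpow_of_exponent_le`), so the sum is
≤ 8β^(−a)Z and (1/8)·that is the leaf. PROVED in glue.lean (`closes`, sorry-free).

Rationale: WHY THIS LINE. Mechanism (the lever, new on this summit's routes and the same one LINE g13-A
`TwistExponentGap` uses at fixed torus): for SU(2) every TEMPORALLY TWISTED flat connection on the
2L × L³ torus is infinitesimally RIGID — some holonomy pair anticommutes (P_t P_k = −P_k P_t), so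
the holonomy image contains the quaternion pair, its centraliser is {±1} and H⁰ = H¹ = 0 (Künneth
with a non-trivial rank-one local system on T⁴) — whereas the periodic sector keeps the twelve toron
zero modes c_μ ∈ su(2), μ = 0..3, governed by the quartic Σ|[c_μ,c_ν]|² with real log-canonical
threshold 3 (+ log, Austing–Wheater: the D = 4 SU(2) Yang–Mills matrix integral diverges
logarithmically). Laplace bookkeeping at fixed L: W_z(univ)/W_0(univ) ≍ β^(−3/2)/log β for every z ≠
0 (massive directions N − dim𝒢 in the twisted sector against N − dim𝒢 − 9 plus the zero-mode factor
β^(−3)·log β in the periodic one), with an L-INDEPENDENT number of twisted flat orbits (Hom(ℤ⁴,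
SU(2)) with prescribed Stiefel–Whitney data, finite) and a one-loop determinant ratio that converges
to a shape constant as L → ∞ (b.c.-dependence of a massless determinant is UV-finite); the
temperature 1/(2L) is always HIGH against the toron level spacing g^(2/3)/L, so the classical count
(not Lüscher's flux gaps) governs the thermal sectors. On the window L ≤ β^a with a < 1/12 the total
dimension d = 18L⁴ satisfies d³ ≪ β, the regime of dimension-explicit Laplace (arXiv:2305.17604),
which is why an L-uniform power a > 0 (any a, not 3/2) is a credible L-sized crux rather than a
hope. Sources: Thooft1979 ([corpus:book:editornd-lattice-gauge-theories-monte-carlo-simulations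
p.549–551] electric flux in a box), GonzalezarroyoAltes1988 and Luscher1983 §2 (twist removes zero
modes; torons), KollerVanbaal1986 / Vanbaal2001 (toron effective theory, vacuum valley),
AustingWheater2001 + arXiv:hep-th/0101071 p.9 (SU(2) D=4 divergence = the log), ForcrandSmekal2002
and [corpus:book:greensite2011-introduction-confinement-problem p.46–48] (Z_tw/Z_per, electric-flux
free energies measured), arXiv:2305.17604 (dimension-explicit Laplace). Imported from: semiclassical
Morse–Bott/Laplace analysis on representation varieties (rigidity of twisted flat connections) into
the thermal transfer-matrix setting of the K2a family. What it does that the listed routes do not: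
ToronSmallBall / QuantileBitPurity / SlowBitWindow / SwapTwistDeficit price events by toron-core
geometry and sheet translates INSIDE the periodic sector and never name the electric-flux sectors;
FemtoTransferGap/LuscherReduction use the fully twist-averaged `physKernel` only;
MarginalTwistOnset/FluxBootstrap want twist suppression L-uniformly at the confinement scale (XL,
9802) — here it is the femto/Laplace-window statement with a NUMBER (gap 3/2 at fixed L) and its own
Monte-Carlo falsifier (sector frequencies of the seam twist in the physAvg ensemble).

RANKED CRUXES. #2 FluxSectorSuppression (crux) — ELECTRIC-FLUX SECTOR SUPPRESSION on the Laplace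
window: there are a > 0, β₀, L₀ such that for β ≥ β₀, L₀ ≤ L ≤ β^a and every seam twist z ≠ 0 the
sector weight `TT.sectorWeight β (2L−1) z 1` (the z-twisted 2L-slice partition function Tr(T_z P_G
𝕂^(2L))) is ≤ β^(−a)·`TT.physTrace L β (2L)`. Fixed-L prediction W_z/Z ≍ β^(−3/2)/log β (rigid
twisted flat connections versus toron zero modes); the crux asks only for SOME uniform power on the
window. [difficulty: L] (why it might fail: L-uniformity: Laplace constants (near-flat lattice
strata within β^(−1/2+ε), determinant ratios, two-loop remainders ∝ g²·polylog L) must stay bounded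
for L ≤ β^a; a hidden e^(cL³) in the Gaussian comparison beats β^(−a) at L ≈ β^a unless a sits below
the d³ ≪ β threshold.) [Thooft1979, GonzalezarroyoAltes1988, Luscher1983, KollerVanbaal1986,
AustingWheater2001, ForcrandSmekal2002, arXiv:2305.17604]
#3 PeriodicCoreRaritySubQuartic (crux) — PERIODIC-SECTOR TORON CORE RARITY: there are γc ≤ 2/5, a >
0, β₀, L₀ such that for β ≥ β₀, L₀ ≤ L ≤ β^a the UNTWISTED sector weight of the slice-0 core event,
`TT.sectorWeight β (2L−1) 0 (𝟙{polDist(U_0) ≤ β^(−γc)})`, is ≤ β^(−a)·`TT.physTrace L β (2L)`. This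
is exactly the part of 23956 that the prover's PLAN-X1 v2 (three-case covariant sheet translates,
Lévy anti-concentration of the toron modulus, log-uniform law on [β^(−1/4),1]) addresses: inside the
periodic sector every holonomy axis field is well defined off the core and no seam sign defect
occurs. [difficulty: L] (why it might fail: the toron modulus law is log-uniform only down to
β^(−1/4)·polylog; if the core {polDist ≤ β^(−γc)}, γc ≤ 2/5 > 1/4, keeps an L-dependent O(1)
fraction of the periodic-sector mass via the collapsed non-abelian region (RLCT tie 12/4 = 6/2), no
uniform power a > 0 survives.) [Luscher1983, Vanbaal2001, KollerVanbaal1986, arXiv:hep-lat/9606014,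
arXiv:2305.17604]
#9 SectorDecomposition (support) — SECTOR DECOMPOSITION (exact, Fubini on `physAvg`; companion
module of `QuantileBitPuritySectorDefs` being landed by prover ym-dw-p1 g14): for every L, β, n and
measurable slice event A, `TT.ringInsTrace L β n 𝟙_A 0 = (1/8) Σ_z TT.sectorWeight β n z
(𝟙_A(U_0))`. [difficulty: S] [Luscher1983, MontvayMunster1994]
#9 SectorWeightMonotone (support) — SECTOR WEIGHTS OF EVENTS ARE NON-NEGATIVE AND MONOTONE: for β ≥
0, measurable A and every z, 0 ≤ W_z(𝟙_A(U_0)) ≤ W_z(1) (the transfer kernel is positive;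
`integral_mono` on the product measure). [difficulty: S] [MontvayMunster1994, Luscher1983]

TWO-LAYER PLAN. K1 may later split (glued) into FixedLFluxSuppression (∀ L ≥ 2 fixed: W_z ≤ C_L
β^(−3/2) Z, Morse–Bott Laplace at the finitely many rigid twisted flat orbits — M) and
WindowUniformity (C_L ≤ β^(3/2−a) for L ≤ β^a — the L-hard part: dimension-explicit Laplace with d³
≪ β plus the toron zero-mode floor of ToronSmallBall's PLAN-X1). K2 keeps the prover's three-case
tree (PLAN-X1 v2) unchanged but now inside sector z = 0 only. The same K1 is the flux input of
23957/23899 (sectors (−,−,±)) and 23949/23923 (sectors (−,·,·) near c = 2) per the memo §2 — to be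
attached there by wanted_by, not re-filed.

KILL CRITERIA. K1 is refuted on the window if a Theorems file proves, for some z ≠ 0, W_z(univ) ≥
β^(−a)·Z_phys(2L) for every a > 0 along a sequence L ≤ β^a, β → ∞ (e.g. an e^(cL³) determinant
defect); numerically the line is killed if the seam-twist sector frequencies p_z/p_0 in the physAvg
ensemble at L = 2, β_W ∈ {16,32,64} decay slower than β^(−1/2) (registered slope test below). K2
dies with ToronSmallBall's PLAN-X1 (core captures an O(1) fraction of the periodic sector uniformly
in β).

NOT DECOMPOSED YET. No split of K1 into fixed-L and uniformity halves until the fixed-L Laplace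
skeleton (birth file) has its Morse–Bott stub proved for L = 2; no re-lining of 23957/23949 until
the critic rules on the memo's §4(ii) alternative (retype to c ≤ 2 − β^(−γc)).

CHEAPEST FALSIFIER. Seam-twist sector frequencies in the existing physAvg heat-bath ensemble (HOME
bc/g12-mc scripts sample the seam twist z dynamically): at L = 2, T = 4, β_W ∈ {16, 32, 64} measure
p_z for the seven z ≠ 0; prediction log-slope of p_z/p_0 in β = −3/2 − 1/log β ≈ −1.8 ± 0.3; KILL if
the fitted slope is shallower than −1/2 for any single-twist z, or if p_z/p_0 does not decrease from
β_W = 16 to 64.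

NUMBERS. SU(2), z ≠ 0: twisted flat connections on T⁴ with one anticommuting pair: h⁰ = h¹ = 0;
periodic: h⁰ = 3, h¹ = 12, zero-mode RLCT 3 with multiplicity 2 (log). Gap = (12 − 3)/2 − 3 = 3/2
(the 9 = h¹ − h⁰ net flat directions at β^(−1/2) each, minus the β^(−3) of the quartic). d = 18L⁴ +
3L³ variables; d³ ≪ β needs L ≤ β^a with a < 1/12. Instrument history: g11 j320851 tree-level
zero-mode integrals gave β′⟨E⟩ → 3 (periodic) confirming RLCT 3; j320281 swap log-slope −0.483 ±
0.038 at β = 64 (a different, spatial twist).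

DEFINITION REQUESTS. None: `TT.sectorWeight`, `TT.gaugeKernel` landed 2026-08-29
(Theorems/QuantileBitPuritySectorDefs.lean, prover ym-dw-p1 g14); `TT.ringInsTrace`, `TT.insTrace`,
`TT.physTrace`, `FlatSheet.polDist` are tree definitions.

Novelty: Searches RUN (2026-08-29): `lit search --hybrid "twisted boundary conditions remove zero modes
perturbation theory torus Yang-Mills"` →
[corpus:book:editornd-lattice-gauge-theories-monte-carlo-simulations p.549–551] ('t Hooft 1979
reprint: twisted gauge fields, electric flux in a box),
[corpus:book:greensite2011-introduction-confinement-problem p.46–48] (vortex/electric free energy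
Z₋/Z₊, Kovács–Tomboulis, de Forcrand–von Smekal); `lit search --hybrid "electric flux free energy
weak coupling finite volume 't Hooft twisted partition function ratio"` → same two + Montvay–Münster
pp.354–357 (no twist content on those pages); `lit vsearch "<twisted partition function suppressed
by a power because twisted flat connections are isolated>"` → noise (percolation, spin glasses) +
Greensite p.46; `lit galaxy search "twist eliminates zero modes|absence of zero modes|twisted
Eguchi-Kawai" --star pdf` → only TEK gradient-flow (arXiv:2410.15668), irrelevant; `lit galaxy
search "electric flux free energy|twisted partition function" --star all` → CFT defect papers, no
lattice YM hit; `rg sectorWeight|twist3|electric.flux` over Theses/ → no route item on electric-flux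
sectors of the thermal ring (ThermalDescent/SqueezedSkewness mention flux sectors only as a
why-might-fail at the confinement scale; LuscherReduction.TwistedTraceScaling is femto-window trace
scaling of the twist-AVERAGED trace). Nearest prior art: the physics «twist removes zero modes,
periodic boxes have torons with a logarithm  [refs: 2410.15668, book:editornd-lattice-gauge-theories-monte-carlo-simulations, book:greensite2011-introduction-confinement-problem, GonzalezarroyoAltes1988, Luscher1983, Vanbaal2001, AustingWheater2001, ForcrandSmekal2002]

Barriers (technique_class: laplace, rigid twisted flats, electric flux sectors): - technique_class: laplace, rigid twisted flats, electric flux sectors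
- Literature.Barriers.QuantumFields.EguchiKawaiBreakdown: outside — no large-N volume reduction or
twisted reduced model; N = 2 fixed, L ≥ L₀ grows, and centre symmetry is USED (sector
decomposition), never assumed unbroken in a reduced model.
- Literature.Barriers.QuantumFields.ElitzurTheorem: outside — every quantity is gauge-invariant
(sector weights integrate the seam gauge field over Haar; events are functions of polDist, a class
function of the holonomy); no gauge-variant order parameter.
- Literature.Barriers.QuantumFields.AbelianDeconfinementD4: outside — the lever is strictly
non-abelian (an ANTICOMMUTING holonomy pair; for U(1) a twisted sector has no flat connection at
all) and the line claims nothing about confinement or the infinite-volume limit: it is a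
femto/Laplace-window statement at fixed aspect ratio 2.
- Literature.Barriers.QuantumFields.ColemanGrossScalarNarrow: outside — no scalar field theory, no
asymptotic-freedom/UV-completion claim, no beta function; the only quartic is the commutator form on
twelve lattice zero modes.
- Literature.Barriers.QuantumFields.CenterSymmetryBreakingByQuarks: outside — pure gauge theory, no
matter fields; the ℤ₂³ electric-flux grading is exact.
- Literature.Barriers.QuantumFields.DiluteInstantonGasDivergence: outside — no instanton gas or
semiclassical sum over topological sectors in infinite volume; finitely many flat orbits on a finite
lattice, Laplace

sub-problem: YangMills · status: draft · opened planner-ym-idea-4-g13-0 2026-08-29T04:19:33Z · rev 0 · ledger route-QuantumFields-FluxSectorLaplace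
GENERATED by the gate from the ledger (D-0016/17). Provers cite these decls: `theorem foo : Summit.QuantumFields.YangMills.Theses.FluxSectorLaplace.<Decl> := …` in Summits/QuantumFields/YangMills/Theorems/<Name>.lean.
-/

namespace Summit.QuantumFields.YangMills.Theses.FluxSectorLaplace

open scoped BigOperators Topology Manifold Classical MeasureTheory ProbabilityTheory Matrix InnerProductSpace ComplexConjugate ContinuousMap
open Filter Set Function TopologicalSpace MeasureTheory

attribute [summit_statement] _root_.YangMills

/-- item stmt-QuantumFields-24079 · crux · rank 2 · closed · proved by Summit.QuantumFields.YangMills.Theorems.FluxSectorLaplace.fluxSectorSuppression_proof (prover) · by planner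
why it might fail: L-uniformity: Laplace constants (near-flat lattice strata within β^(−1/2+ε), determinant ratios, two-loop remainders ∝ g²·polylog L) must stay bounded for L ≤ β^a; a hidden e^(cL³) in the Gaussian comparison beats β^(−a) at L ≈ β^a unless a sits below the d³ ≪ β threshold.
sources: Thooft1979, GonzalezarroyoAltes1988, Luscher1983, KollerVanbaal1986, AustingWheater2001, ForcrandSmekal2002
[crux] ELECTRIC-FLUX SECTOR SUPPRESSION on the Laplace window: there are a > 0, β₀, L₀ such that for
β ≥ β₀, L₀ ≤ L ≤ β^a and every seam twist z ≠ 0 the sector weight `TT.sectorWeight β (2L−1) z 1`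
(the z-twisted 2L-slice partition function Tr(T_z P_G 𝕂^(2L))) is ≤ β^(−a)·`TT.physTrace L β (2L)`.
Fixed-L prediction W_z/Z ≍ β^(−3/2)/log β (rigid twisted flat connections versus toron zero modes);
the crux asks only for SOME uniform power on the window. [difficulty: L] -/
@[route_item "route-QuantumFields-FluxSectorLaplace", crux]
def FluxSectorSuppression : Prop :=
  ∃ a : ℝ, 0 < a ∧ ∃ β₀ : ℝ, ∃ L₀ : ℕ, ∀ β : ℝ, β₀ ≤ β → ∀ (L : ℕ) [NeZero L], L₀ ≤ L → (L : ℝ) ≤ β ^ a → ∀ z : Fin 3 → Bool, z ≠ (fun _ => false) → Summit.QuantumFields.YangMills.Theorems.FemtoTransferGap.TT.sectorWeight (L := L) β (2 * L - 1) z (fun _ _ => (1 : ℝ)) ≤ β ^ (-a) * Summit.QuantumFields.YangMills.Theorems.FemtoTransferGap.TT.physTrace L β (2 * L)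

-- `FluxSectorSuppression` holds: proved by `Summit.QuantumFields.YangMills.Theorems.FluxSectorLaplace.fluxSectorSuppression_proof` (its module imports this route file, so no `_holds` link can be stated here).

/-- item stmt-QuantumFields-24080 · crux · rank 3 · closed · proved by Summit.QuantumFields.YangMills.Theorems.FluxSectorLaplace.periodicCoreRaritySubQuartic_proof (prover) · by planner
why it might fail: the toron modulus law is log-uniform only down to β^(−1/4)·polylog; if the core {polDist ≤ β^(−γc)}, γc ≤ 2/5 > 1/4, keeps an L-dependent O(1) fraction of the periodic-sector mass via the collapsed non-abelian region (RLCT tie 12/4 = 6/2), no uniform power a > 0 survives.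
sources: Luscher1983, Vanbaal2001, KollerVanbaal1986, arXiv:hep-lat/9606014, arXiv:2305.17604
[crux] PERIODIC-SECTOR TORON CORE RARITY: there are γc ≤ 2/5, a > 0, β₀, L₀ such that for β ≥ β₀, L₀
≤ L ≤ β^a the UNTWISTED sector weight of the slice-0 core event, `TT.sectorWeight β (2L−1) 0
(𝟙{polDist(U_0) ≤ β^(−γc)})`, is ≤ β^(−a)·`TT.physTrace L β (2L)`. This is exactly the part of 23956
that the prover's PLAN-X1 v2 (three-case covariant sheet translates, Lévy anti-concentration of the
toron modulus, log-uniform law on [β^(−1/4),1]) addresses: inside the periodic sector every holonomy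
axis field is well defined off the core and no seam sign defect occurs. [difficulty: L] -/
@[route_item "route-QuantumFields-FluxSectorLaplace", crux]
def PeriodicCoreRaritySubQuartic : Prop :=
  ∃ γc : ℝ, γc ≤ 2 / 5 ∧ ∃ a : ℝ, 0 < a ∧ ∃ β₀ : ℝ, ∃ L₀ : ℕ, ∀ β : ℝ, β₀ ≤ β → ∀ (L : ℕ) [NeZero L], L₀ ≤ L → (L : ℝ) ≤ β ^ a → Summit.QuantumFields.YangMills.Theorems.FemtoTransferGap.TT.sectorWeight (L := L) β (2 * L - 1) (fun _ => false) (fun Us _ => Set.indicator {U : Literature.MathematicalPhysics.QuantumFieldTheory.GaugeConfig 3 L Summit.QuantumFields.YangMills.Theorems.FemtoTransferGap.SU2 | Summit.QuantumFields.YangMills.Theorems.FemtoTransferGap.FlatSheet.polDist U ≤ β ^ (-γc)} (fun _ => (1 : ℝ)) (Us 0)) ≤ β ^ (-a) * Summit.QuantumFields.YangMills.Theorems.FemtoTransferGap.TT.physTrace L β (2 * L)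

-- `PeriodicCoreRaritySubQuartic` holds: proved by `Summit.QuantumFields.YangMills.Theorems.FluxSectorLaplace.periodicCoreRaritySubQuartic_proof` (its module imports this route file, so no `_holds` link can be stated here).

/-- item stmt-QuantumFields-24081 · support · rank 9 · closed · proved by Summit.QuantumFields.YangMills.Theorems.FluxSectorLaplace.sectorDecomposition_proof (prover) · by planner
sources: Luscher1983, MontvayMunster1994
[support] SECTOR DECOMPOSITION (exact, Fubini on `physAvg`; companion module of
`QuantileBitPuritySectorDefs` being landed by prover ym-dw-p1 g14): for every L, β, n and measurable
slice event A, `TT.ringInsTrace L β n 𝟙_A 0 = (1/8) Σ_z TT.sectorWeight β n z (𝟙_A(U_0))`.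
[difficulty: S] -/
@[route_item "route-QuantumFields-FluxSectorLaplace", crux]
def SectorDecomposition : Prop :=
  ∀ (L : ℕ) [NeZero L] (β : ℝ) (n : ℕ) (A : Set (Literature.MathematicalPhysics.QuantumFieldTheory.GaugeConfig 3 L Summit.QuantumFields.YangMills.Theorems.FemtoTransferGap.SU2)), MeasurableSet A → Summit.QuantumFields.YangMills.Theorems.FemtoTransferGap.TT.ringInsTrace L β n (A.indicator fun _ => (1 : ℝ)) 0 = (1 / 8 : ℝ) * ∑ z : Fin 3 → Bool, Summit.QuantumFields.YangMills.Theorems.FemtoTransferGap.TT.sectorWeight (L := L) β n z (fun Us _ => A.indicator (fun _ => (1 : ℝ)) (Us 0))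

-- `SectorDecomposition` holds: proved by `Summit.QuantumFields.YangMills.Theorems.FluxSectorLaplace.sectorDecomposition_proof` (its module imports this route file, so no `_holds` link can be stated here).

/-- item stmt-QuantumFields-24082 · support · rank 9 · closed · proved by Summit.QuantumFields.YangMills.Theorems.FluxSectorLaplace.sectorWeightMonotone_proof (prover) · by planner
sources: MontvayMunster1994, Luscher1983
[support] SECTOR WEIGHTS OF EVENTS ARE NON-NEGATIVE AND MONOTONE: for β ≥ 0, measurable A and every
z, 0 ≤ W_z(𝟙_A(U_0)) ≤ W_z(1) (the transfer kernel is positive; `integral_mono` on the product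
measure). [difficulty: S] -/
@[route_item "route-QuantumFields-FluxSectorLaplace", crux]
def SectorWeightMonotone : Prop :=
  ∀ (L : ℕ) [NeZero L] (β : ℝ) (n : ℕ) (z : Fin 3 → Bool) (A : Set (Literature.MathematicalPhysics.QuantumFieldTheory.GaugeConfig 3 L Summit.QuantumFields.YangMills.Theorems.FemtoTransferGap.SU2)), MeasurableSet A → 0 ≤ β → 0 ≤ Summit.QuantumFields.YangMills.Theorems.FemtoTransferGap.TT.sectorWeight (L := L) β n z (fun Us _ => A.indicator (fun _ => (1 : ℝ)) (Us 0)) ∧ Summit.QuantumFields.YangMills.Theorems.FemtoTransferGap.TT.sectorWeight (L := L) β n z (fun Us _ => A.indicator (fun _ => (1 : ℝ)) (Us 0)) ≤ Summit.QuantumFields.YangMills.Theorems.FemtoTransferGap.TT.sectorWeight (L := L) β n z (fun _ _ => (1 : ℝ))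

-- `SectorWeightMonotone` holds: proved by `Summit.QuantumFields.YangMills.Theorems.FluxSectorLaplace.sectorWeightMonotone_proof` (its module imports this route file, so no `_holds` link can be stated here).

/-- item stmt-QuantumFields-24083 · assembly · rank 1 · closed · proved by Summit.QuantumFields.YangMills.Theorems.FluxSectorLaplace.assembly_proof (prover) · by planner
sources: Luscher1983, Thooft1979
[assembly] FluxSectorSuppression → PeriodicCoreRaritySubQuartic → SectorDecomposition →
SectorWeightMonotone → ToronCoreRaritySubQuartic (eight-term bookkeeping; proof in hand = the
`closes` theorem). [deps: FluxSectorSuppression, PeriodicCoreRaritySubQuartic, SectorDecomposition,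
SectorWeightMonotone] [difficulty: S] -/
@[route_item "route-QuantumFields-FluxSectorLaplace"]
def Assembly : Prop :=
  FluxSectorSuppression → PeriodicCoreRaritySubQuartic → SectorDecomposition → SectorWeightMonotone → Summit.QuantumFields.YangMills.Theses.ToronSmallBall.ToronCoreRaritySubQuartic

-- `Assembly` holds: proved by `Summit.QuantumFields.YangMills.Theorems.FluxSectorLaplace.assembly_proof` (its module imports this route file, so no `_holds` link can be stated here).

/-! D-0027 §2.1 — DECIDING THEOREM (planner-authored via `route open/edit --closes-file`; by planner-ym-idea-4-g13-0 2026-08-29T04:19:33Z):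
its hypotheses are this route's items and its conclusion the sub-problem Statement (glue_lint), and it elaborates with this file. -/

@[closes "route-QuantumFields-FluxSectorLaplace"] theorem closes (hF : FluxSectorSuppression) (hP : PeriodicCoreRaritySubQuartic) (hD : SectorDecomposition)
    (hM : SectorWeightMonotone) :
    Summit.QuantumFields.YangMills.Theses.ToronSmallBall.ToronCoreRaritySubQuartic := by
  obtain ⟨a₁, ha₁, β₁, L₁, hF⟩ := hF
  obtain ⟨γc, hγc, a₂, ha₂, β₂, L₂, hP⟩ := hP
  refine ⟨γc, hγc, min a₁ a₂, lt_min ha₁ ha₂, max (max β₁ β₂) 1, max (max L₁ L₂) 1, ?_⟩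
  intro β hβ L _ hL hLwin
  have hβ1 : 1 ≤ β := le_trans (le_max_right _ _) hβ
  have hββ1 : β₁ ≤ β := le_trans (le_trans (le_max_left _ _) (le_max_left _ _)) hβ
  have hββ2 : β₂ ≤ β := le_trans (le_trans (le_max_right _ _) (le_max_left _ _)) hβ
  have hL1 : L₁ ≤ L := le_trans (le_trans (le_max_left _ _) (le_max_left _ _)) hL
  have hL2 : L₂ ≤ L := le_trans (le_trans (le_max_right _ _) (le_max_left _ _)) hL
  have hLone : 1 ≤ L := le_trans (le_max_right _ _) hL
  have hβ0 : 0 ≤ β := by linarith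
  -- windows
  have hwin1 : (L : ℝ) ≤ β ^ a₁ :=
    hLwin.trans (Real.rpow_le_rpow_of_exponent_le hβ1 (min_le_left _ _))
  have hwin2 : (L : ℝ) ≤ β ^ a₂ :=
    hLwin.trans (Real.rpow_le_rpow_of_exponent_le hβ1 (min_le_right _ _))
  set A : Set (Literature.MathematicalPhysics.QuantumFieldTheory.GaugeConfig 3 L
      Summit.QuantumFields.YangMills.Theorems.FemtoTransferGap.SU2) :=
    {U | Summit.QuantumFields.YangMills.Theorems.FemtoTransferGap.FlatSheet.polDist U ≤ β ^ (-γc)} with hA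
  have hAm : MeasurableSet A :=
    Summit.QuantumFields.YangMills.Theorems.QuantileBitPurity.measurableSet_polDist_le _
  set Z := Summit.QuantumFields.YangMills.Theorems.FemtoTransferGap.TT.physTrace L β (2 * L) with hZ
  have hZpos : 0 < Z :=
    Summit.QuantumFields.YangMills.Theorems.FemtoTransferGap.TT.physTrace_two_mul_pos hLone hβ1
  -- exponent monotonicity
  have hmono : ∀ a' : ℝ, min a₁ a₂ ≤ a' → β ^ (-a') * Z ≤ β ^ (-min a₁ a₂) * Z := by
    intro a' ha'
    refine mul_le_mul_of_nonneg_right ?_ hZpos.le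
    exact Real.rpow_le_rpow_of_exponent_le hβ1 (by linarith)
  -- per-sector bound
  have hsec : ∀ z : Fin 3 → Bool,
      Summit.QuantumFields.YangMills.Theorems.FemtoTransferGap.TT.sectorWeight (L := L) β (2 * L - 1) z
          (fun Us _ => A.indicator (fun _ => (1 : ℝ)) (Us 0)) ≤ β ^ (-min a₁ a₂) * Z := by
    intro z
    by_cases hz : z = fun _ => false
    · subst hz
      exact (hP β hββ2 L hL2 hwin2).trans (hmono a₂ (min_le_right _ _))
    · have h1 := (hM L β (2 * L - 1) z A hAm hβ0).2
      exact h1.trans ((hF β hββ1 L hL1 hwin1 z hz).trans (hmono a₁ (min_le_left _ _)))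
  -- sum over the eight sectors
  have hcard : (Finset.univ : Finset (Fin 3 → Bool)).card = 8 := by
    simp [Finset.card_univ, Fintype.card_fun, Fintype.card_bool, Fintype.card_fin]
  have hsum : ∑ z : Fin 3 → Bool,
      Summit.QuantumFields.YangMills.Theorems.FemtoTransferGap.TT.sectorWeight (L := L) β (2 * L - 1) z
          (fun Us _ => A.indicator (fun _ => (1 : ℝ)) (Us 0)) ≤ 8 * (β ^ (-min a₁ a₂) * Z) := by
    have := Finset.sum_le_card_nsmul (Finset.univ : Finset (Fin 3 → Bool)) _ _ fun z _ => hsec z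
    rw [hcard] at this
    simpa [nsmul_eq_mul] using this
  -- rewrite the insertion trace through the decomposition
  have hdec := hD L β (2 * L - 1) A hAm
  rw [Summit.QuantumFields.YangMills.Theorems.FemtoTransferGap.TT.ringInsTrace_two_mul_sub_one] at hdec
  rw [hdec]
  linarith

end Summit.QuantumFields.YangMills.Theses.FluxSectorLaplace
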